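import Literature.NumberTheory.LFunctions.ClassGroupMeanValue
import HarnessLib

/-!
# The size of the mean value constant `h_K · M` (log-free saving)

Topic `Literature/NumberTheory/LFunctions`, namespace `Literature.NumberTheory.LFunctions.NumberField`.
Everything here is PROVED (theorems only; no named facts).

The constant of `ClassGroupMeanValue.classGroup_meanValue_le` is `8π h_K M`,
`M = κ₀/V'(z) + |D_z|² err(log y − (m+1)/A) z` (`κ₀ = κ_K/h_K`).  Combining the elementary bounds of
`ClassGroupSieveDensity` — `V(z) ≤ e^{n_K} V'(z)`, `V(z) ≥ κ_K (log z − u₀ − (m+1)/A)/(4(m+1))` when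
`h_K err(u₀) ≤ κ_K/2`, `e^{u₀ + (m+1)/A} ≤ z`, and `|D_z| ≤ z^{n_K+1}` — gives

* `card_mul_meanValueConst_le` —
  `h_K M ≤ 4(m+1) e^{n_K}/(log z − u₀ − (m+1)/A) + h_K z^{2(n_K+1)} err(log y − (m+1)/A) z`,

i.e. the saving `1/log z` of the log-free large sieve, with an explicit secondary term.

## References

* [ThornerZaman2017] J. Thorner, A. Zaman, Algebra Number Theory 11 (2017), Theorem 4.2, (4-4).
-/

noncomputable section

open Real Finset IsDedekindDomain Filter
open scoped Topology

namespace Literature.NumberTheory.LFunctions.NumberField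

open Literature.NumberTheory.LFunctions.WeissKernel Literature.NumberTheory.Sieve.Squarefree
open scoped nonZeroDivisors _root_.NumberField Classical

variable {K : Type*} [Field K] [NumberField K]

/-- **`h_K M ≤ 4(m+1)e^{n_K}/(log z − u₀ − (m+1)/A) + h_K z^{2(n_K+1)} err(log y − (m+1)/A) z`.**
[cite: ThornerZaman2017, Theorem 4.2] -/
theorem card_mul_meanValueConst_le {A : ℝ} (hA : 0 < A) {m : ℕ} (hm : Module.finrank ℚ K + 3 ≤ m)
    {z : ℝ} (hz1 : 1 ≤ z) (y : ℝ) {u₀ : ℝ}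
    (hu₀ : Fintype.card (ClassGroup (𝓞 K)) * lemma44Err K A m u₀ ≤ NumberField.dedekindZeta_residue K / 2)
    (hzu : 1 ≤ Real.log z - u₀ - ((m : ℝ) + 1) / A) :
    Fintype.card (ClassGroup (𝓞 K)) * meanValueConst K A m z y ≤
      4 * ((m : ℝ) + 1) * Real.exp (Module.finrank ℚ K) / (Real.log z - u₀ - ((m : ℝ) + 1) / A) +
        Fintype.card (ClassGroup (𝓞 K)) * z ^ (2 * (Module.finrank ℚ K + 1)) *
          (lemma44Err K A m (Real.log y - ((m : ℝ) + 1) / A) * z) := by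
  set κ := NumberField.dedekindZeta_residue K with hκ
  set h : ℕ := Fintype.card (ClassGroup (𝓞 K)) with hh
  set n : ℕ := Module.finrank ℚ K with hn
  set L : ℝ := Real.log z - u₀ - ((m : ℝ) + 1) / A with hL
  set Vp : ℝ := bigV (fun v : HeightOneSpectrum (𝓞 K) ↦ (Ideal.absNorm v.asIdeal : ℝ)) (admissible K z) with hVp
  set V : ℝ := ∑ I ∈ idealsNormLE K ⌊z⌋₊, ((Ideal.absNorm I : ℕ) : ℝ)⁻¹ with hV
  have hκ0 : 0 < κ := NumberField.dedekindZeta_residue_pos K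
  have hh0 : (0 : ℝ) < h := by rw [hh]; exact_mod_cast Fintype.card_pos
  have hz0 : 0 ≤ z := by linarith
  have hN : ∀ v : HeightOneSpectrum (𝓞 K), 1 < (Ideal.absNorm v.asIdeal : ℝ) := one_lt_absNorm_real
  have hVp0 : 0 < Vp := bigV_pos hN ⟨∅, empty_mem_admissible (K := K) hz1⟩
  -- `z ≥ e^{u₀ + (m+1)/A}`
  have hzexp : Real.exp (u₀ + ((m : ℝ) + 1) / A) ≤ z := by
    have hz0' : 0 < z := by linarith
    rw [← Real.exp_log hz0']
    exact Real.exp_le_exp.mpr (by linarith)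
  -- `V ≥ κ L/(4(m+1))` and `V ≤ e^n Vp`
  have hVlow : κ * L / (4 * ((m : ℝ) + 1)) ≤ V := residue_mul_log_le_sum_inv hA hm hu₀ hzexp
  have hVup : V ≤ Real.exp n * Vp := by
    have := sum_idealsNormLE_inv_le (K := K) hz0
    rw [hV]; convert this using 2
  have hL0 : 0 < L := by linarith
  have hV0 : 0 < V := lt_of_lt_of_le (by positivity) hVlow
  -- the main term: `h · (κ/h)/Vp = κ/Vp ≤ e^n κ/V ≤ 4(m+1)e^n/L`
  have hmain : (h : ℝ) * ((classTwistedZeta₁ K (fun _ ↦ (1 : ℂ)) 1 / Fintype.card (ClassGroup (𝓞 K))).re / Vp) ≤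
      4 * ((m : ℝ) + 1) * Real.exp n / L := by
    rw [Complex.div_natCast_re, re_classTwistedZeta₁_one_one, ← hκ, ← hh]
    have e1 : (h : ℝ) * (κ / h / Vp) = κ / Vp := by field_simp
    rw [e1, div_le_div_iff₀ hVp0 hL0]
    -- `κ L ≤ 4(m+1) V ≤ 4(m+1) e^n Vp`
    have h1 : κ * L ≤ 4 * ((m : ℝ) + 1) * V := by
      rw [div_le_iff₀ (by positivity)] at hVlow; linarith
    have h2 : 4 * ((m : ℝ) + 1) * V ≤ 4 * ((m : ℝ) + 1) * (Real.exp n * Vp) :=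
      mul_le_mul_of_nonneg_left hVup (by positivity)
    nlinarith
  -- the secondary term
  have herr0 : 0 ≤ lemma44Err K A m (Real.log y - ((m : ℝ) + 1) / A) * z := by
    refine mul_nonneg ?_ hz0
    rw [lemma44Err]; have := majorConst_pos A m (Module.finrank ℚ K + 1); positivity
  have hD : ((admissible K z).card : ℝ) ^ 2 ≤ z ^ (2 * (n + 1)) := by
    rw [pow_mul']
    exact pow_le_pow_left₀ (Nat.cast_nonneg _) (card_admissible_le_pow hz0) 2
  rw [meanValueConst, mul_add, ← hVp]
  refine add_le_add hmain ?_
  rw [← mul_assoc]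
  refine mul_le_mul_of_nonneg_right ?_ herr0
  exact mul_le_mul_of_nonneg_left hD hh0.le

/-! ### Numerical bounds under the size hypotheses `|d_K|, h_K, 1/κ_K ≤ P`, `n_K ≤ 4` -/

/-- `majorConst (2T') (n+3) (n+1) ≤ e^{40} T'^{15}` for `n ≤ 4`, `T' ≥ 1`. [folklore] -/
theorem majorConst_two_mul_le {n : ℕ} (hn : n ≤ 4) {T' : ℝ} (hT : 1 ≤ T') :
    majorConst (2 * T') (n + 3) (n + 1) ≤ Real.exp 40 * T' ^ 15 := by
  rw [majorConst]
  have hT0 : 0 < T' := by linarith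
  have hmax : max 1 (2 * T') = 2 * T' := max_eq_right (by linarith)
  rw [hmax]
  -- the exponential factor: `3(n+4)/(4T') ≤ 6`
  have h1 : Real.exp (3 * ((n + 3 : ℕ) + 1) / (2 * (2 * T'))) ≤ Real.exp 6 := by
    refine Real.exp_le_exp.mpr ?_
    rw [div_le_iff₀ (by positivity)]
    have : ((n + 3 : ℕ) : ℝ) + 1 ≤ 8 := by
      have : (n : ℝ) ≤ 4 := by exact_mod_cast hn
      push_cast; linarith
    nlinarith
  -- `(11/2)^{n+1} ≤ (11/2)^5 ≤ e^{9}`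
  have h2 : ((11 : ℝ) / 2) ^ (n + 1) ≤ Real.exp 9 := by
    calc ((11 : ℝ) / 2) ^ (n + 1) ≤ ((11 : ℝ) / 2) ^ 5 := pow_le_pow_right₀ (by norm_num) (by omega)
      _ ≤ 5033 := by norm_num
      _ ≤ Real.exp 9 := by
          have := Real.exp_one_gt_d9
          have h : Real.exp 9 = (Real.exp 1) ^ 9 := by rw [← Real.exp_nat_mul]; norm_num
          rw [h]
          calc (5033 : ℝ) ≤ (2.7 : ℝ) ^ 9 := by norm_num
            _ ≤ (Real.exp 1) ^ 9 := pow_le_pow_left₀ (by norm_num) (by linarith) 9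
  -- `(1 + 2T')^{2n+7} ≤ (3T')^{15}`
  have h3 : (1 + 2 * T') ^ ((n + 3) + (n + 1) + 3) ≤ (3 * T') ^ 15 := by
    calc (1 + 2 * T') ^ ((n + 3) + (n + 1) + 3) ≤ (3 * T') ^ ((n + 3) + (n + 1) + 3) :=
          pow_le_pow_left₀ (by positivity) (by linarith) _
      _ ≤ (3 * T') ^ 15 := pow_le_pow_right₀ (by linarith) (by omega)
  have h4 : (3 : ℝ) ^ 15 ≤ Real.exp 17 := by
    have := Real.exp_one_gt_d9
    have h : Real.exp 17 = (Real.exp 1) ^ 17 := by rw [← Real.exp_nat_mul]; norm_num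
    rw [h]
    calc (3 : ℝ) ^ 15 ≤ (2.7 : ℝ) ^ 17 := by norm_num
      _ ≤ (Real.exp 1) ^ 17 := pow_le_pow_left₀ (by norm_num) (by linarith) 17
  have hexp : Real.exp 40 = 2 * Real.exp 6 * Real.exp 9 * Real.exp 17 * (Real.exp 8 / 2) := by
    have : (40 : ℝ) = 6 + 9 + 17 + 8 := by norm_num
    rw [this, Real.exp_add, Real.exp_add, Real.exp_add]; ring
  have h8 : (1 : ℝ) ≤ Real.exp 8 / 2 := by
    have : (2 : ℝ) ≤ Real.exp 8 := by linarith [Real.add_one_le_exp (8 : ℝ)]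
    linarith
  calc 2 * Real.exp (3 * ((n + 3 : ℕ) + 1) / (2 * (2 * T'))) * (11 / 2) ^ (n + 1) * (1 + 2 * T') ^ ((n + 3) + (n + 1) + 3)
      ≤ 2 * Real.exp 6 * Real.exp 9 * (3 * T') ^ 15 := by gcongr
    _ = 2 * Real.exp 6 * Real.exp 9 * 3 ^ 15 * T' ^ 15 := by ring
    _ ≤ 2 * Real.exp 6 * Real.exp 9 * Real.exp 17 * T' ^ 15 := by gcongr
    _ ≤ 2 * Real.exp 6 * Real.exp 9 * Real.exp 17 * (Real.exp 8 / 2) * T' ^ 15 := by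
        have h0 : 0 ≤ 2 * Real.exp 6 * Real.exp 9 * Real.exp 17 * T' ^ 15 := by positivity
        nlinarith
    _ = Real.exp 40 * T' ^ 15 := by rw [hexp]

variable (K) in
/-- The balancing point `u₀ = (2/3) log(2 h_K |d_K| e^{2n} C/(3κ_K))`, `C = majorConst A m (n+1)`:
`h_K err(u₀) = κ_K/2` exactly. [folklore] -/
def balancePoint (A : ℝ) (m : ℕ) : ℝ :=
  2 / 3 * Real.log (2 * Fintype.card (ClassGroup (𝓞 K)) * ((NumberField.discr K).natAbs : ℝ) *
    Real.exp (2 * Module.finrank ℚ K) * majorConst A m (Module.finrank ℚ K + 1) / (3 * NumberField.dedekindZeta_residue K))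

/-- **`h_K err(u₀) = κ_K/2`** at the balancing point. [folklore] -/
theorem card_mul_lemma44Err_balancePoint (A : ℝ) (m : ℕ) :
    Fintype.card (ClassGroup (𝓞 K)) * lemma44Err K A m (balancePoint K A m) = NumberField.dedekindZeta_residue K / 2 := by
  set κ := NumberField.dedekindZeta_residue K with hκ
  set h : ℕ := Fintype.card (ClassGroup (𝓞 K)) with hh
  set C := majorConst A m (Module.finrank ℚ K + 1) with hC
  set d : ℝ := ((NumberField.discr K).natAbs : ℝ) with hd
  set E := Real.exp (2 * Module.finrank ℚ K) with hE
  have hκ0 : 0 < κ := NumberField.dedekindZeta_residue_pos K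
  have hh0 : (0 : ℝ) < h := by rw [hh]; exact_mod_cast Fintype.card_pos
  have hC0 : 0 < C := majorConst_pos A m _
  have hd0 : 0 < d := by rw [hd]; exact_mod_cast Int.natAbs_pos.mpr (NumberField.discr_ne_zero K)
  have hE0 : 0 < E := Real.exp_pos _
  set X : ℝ := 2 * h * d * E * C / (3 * κ) with hX
  have hX0 : 0 < X := by positivity
  have hexp : Real.exp (-(3 / 2 * (2 / 3 * Real.log X))) = X⁻¹ := by
    rw [show -(3 / 2 * (2 / 3 * Real.log X)) = -Real.log X by ring, Real.exp_neg, Real.exp_log hX0]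
  rw [lemma44Err, balancePoint, ← hh, ← hd, ← hE, ← hC, ← hκ, ← hX, hexp, hX]
  field_simp

/-- **`u₀ ≤ 100 log P`** under the size hypotheses (`A = 2T'`, `m = n + 3`, `n ≤ 4`, `1 ≤ T' ≤ 2P`,
`|d_K| ≤ P`, `h_K ≤ P`, `P⁻¹ ≤ κ_K`, `P ≥ 2`). [folklore] -/
theorem balancePoint_le {P T' : ℝ} (hP : 2 ≤ P) (hT : 1 ≤ T') (hT2 : T' ≤ 2 * P)
    (hn : Module.finrank ℚ K ≤ 4)
    (hd : ((NumberField.discr K).natAbs : ℝ) ≤ P) (hh : (Fintype.card (ClassGroup (𝓞 K)) : ℝ) ≤ P)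
    (hκ : P⁻¹ ≤ NumberField.dedekindZeta_residue K) :
    balancePoint K (2 * T') (Module.finrank ℚ K + 3) ≤ 100 * Real.log P := by
  set n : ℕ := Module.finrank ℚ K with hn'
  set κ := NumberField.dedekindZeta_residue K with hκ'
  set h : ℕ := Fintype.card (ClassGroup (𝓞 K)) with hh'
  set C := majorConst (2 * T') (n + 3) (n + 1) with hC
  set d : ℝ := ((NumberField.discr K).natAbs : ℝ) with hd'
  have hP0 : 0 < P := by linarith
  have hLp : Real.log 2 ≤ Real.log P := Real.log_le_log (by norm_num) hP
  have hl2 : (0.69 : ℝ) ≤ Real.log 2 := by have := Real.log_two_gt_d9; linarith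
  have hκ0 : 0 < κ := NumberField.dedekindZeta_residue_pos K
  have hh0 : (0 : ℝ) < h := by rw [hh']; exact_mod_cast Fintype.card_pos
  have hh1 : (1 : ℝ) ≤ h := by rw [hh']; exact_mod_cast Fintype.card_pos
  have hC1 : 0 < C := majorConst_pos _ _ _
  have hd1 : (1 : ℝ) ≤ d := by rw [hd']; exact_mod_cast Int.natAbs_pos.mpr (NumberField.discr_ne_zero K)
  have hCle : C ≤ Real.exp 40 * T' ^ 15 := majorConst_two_mul_le hn hT
  -- `X = 2 h d e^{2n} C/(3κ) ≤ P · P · e^8 · e^{40} (2P)^{15} · P`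
  set X : ℝ := 2 * h * d * Real.exp (2 * n) * C / (3 * κ) with hX
  have hX0 : 0 < X := by positivity
  have hinvκ : κ⁻¹ ≤ P := inv_le_of_inv_le₀ hP0 hκ
  have hE : Real.exp (2 * (n : ℝ)) ≤ Real.exp 8 := by
    refine Real.exp_le_exp.mpr ?_
    have : (n : ℝ) ≤ 4 := by exact_mod_cast hn
    linarith
  have hT15 : T' ^ 15 ≤ (2 * P) ^ 15 := pow_le_pow_left₀ (by linarith) hT2 15
  have hXle : X ≤ Real.exp 59 * P ^ 18 := by
    have hXeq : X = 2 * (h : ℝ) * d * Real.exp (2 * n) * C / 3 * κ⁻¹ := by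
      rw [hX]; field_simp
    rw [hXeq]
    have h3 : (2 : ℝ) * h * d * Real.exp (2 * n) * C / 3 ≤ h * d * Real.exp (2 * n) * C := by
      have : 0 ≤ (h : ℝ) * d * Real.exp (2 * n) * C := by positivity
      linarith
    calc 2 * (h : ℝ) * d * Real.exp (2 * n) * C / 3 * κ⁻¹ ≤ (h * d * Real.exp (2 * n) * C) * P :=
          mul_le_mul h3 hinvκ (inv_nonneg.mpr hκ0.le) (by positivity)
      _ ≤ (P * P * Real.exp 8 * (Real.exp 40 * (2 * P) ^ 15)) * P := by
          gcongr
          exact hCle.trans (mul_le_mul_of_nonneg_left hT15 (by positivity))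
      _ = Real.exp 8 * Real.exp 40 * 2 ^ 15 * P ^ 18 := by ring
      _ ≤ Real.exp 59 * P ^ 18 := by
          have h59 : Real.exp 59 = Real.exp 8 * Real.exp 40 * Real.exp 11 := by
            rw [← Real.exp_add, ← Real.exp_add]; norm_num
          rw [h59]
          have h11 : (2 : ℝ) ^ 15 ≤ Real.exp 11 := by
            have := Real.exp_one_gt_d9
            have h : Real.exp 11 = (Real.exp 1) ^ 11 := by rw [← Real.exp_nat_mul]; norm_num
            rw [h]
            calc (2 : ℝ) ^ 15 ≤ (2.7 : ℝ) ^ 11 := by norm_num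
              _ ≤ (Real.exp 1) ^ 11 := pow_le_pow_left₀ (by norm_num) (by linarith) 11
          have : 0 ≤ Real.exp 8 * Real.exp 40 * P ^ 18 := by positivity
          nlinarith
  have hlogX : Real.log X ≤ 59 + 18 * Real.log P := by
    have h1 := Real.log_le_log hX0 hXle
    rw [Real.log_mul (by positivity) (by positivity), Real.log_exp, Real.log_pow] at h1
    push_cast at h1
    linarith
  rw [balancePoint, ← hn', ← hh', ← hd', ← hC, ← hκ', ← hX]
  show 2 / 3 * Real.log X ≤ 100 * Real.log P
  nlinarith

/-- **The secondary term is `≤ P^{111} N_X^{−1/8}`** once `z⁸ ≤ N_X`, `1 ≤ N_X` (size hypotheses as in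
`balancePoint_le`, `A = 2T'`, `m = n+3`). [folklore] -/
theorem secondary_le {P T' : ℝ} (hP : 2 ≤ P) (hT : 1 ≤ T') (hT2 : T' ≤ 2 * P)
    (hn : Module.finrank ℚ K ≤ 4)
    (hd : ((NumberField.discr K).natAbs : ℝ) ≤ P) (hh : (Fintype.card (ClassGroup (𝓞 K)) : ℝ) ≤ P)
    {z NX : ℝ} (hz0 : 0 ≤ z) (hz8 : z ^ 8 ≤ NX) (hNX : 1 ≤ NX) :
    Fintype.card (ClassGroup (𝓞 K)) * z ^ (2 * (Module.finrank ℚ K + 1)) *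
        (lemma44Err K (2 * T') (Module.finrank ℚ K + 3) (Real.log NX - (((Module.finrank ℚ K + 3 : ℕ) : ℝ) + 1) / (2 * T')) * z) ≤
      P ^ 111 * (NX ^ ((1 : ℝ) / 8))⁻¹ := by
  set n : ℕ := Module.finrank ℚ K with hn'
  set h : ℕ := Fintype.card (ClassGroup (𝓞 K)) with hh'
  set C := majorConst (2 * T') (n + 3) (n + 1) with hC
  set d : ℝ := ((NumberField.discr K).natAbs : ℝ) with hd'
  have hP0 : 0 < P := by linarith
  have hP1 : 1 ≤ P := by linarith
  have hNX0 : 0 < NX := lt_of_lt_of_le one_pos hNX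
  have hh0 : (0 : ℝ) ≤ h := Nat.cast_nonneg _
  have hd0 : 0 ≤ d := Nat.cast_nonneg _
  have hC0 : 0 < C := majorConst_pos _ _ _
  have hCle : C ≤ Real.exp 40 * T' ^ 15 := majorConst_two_mul_le hn hT
  -- `w = NX^{1/8}`, `z ≤ w`, `1 ≤ w`
  set w : ℝ := NX ^ ((1 : ℝ) / 8) with hw
  have hw0 : 0 < w := Real.rpow_pos_of_pos hNX0 _
  have hw8 : w ^ 8 = NX := by
    rw [hw, ← Real.rpow_natCast, ← Real.rpow_mul hNX0.le]; norm_num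
  have hzw : z ≤ w := by
    have : z ^ 8 ≤ w ^ 8 := by rw [hw8]; exact hz8
    exact le_of_pow_le_pow_left₀ (by norm_num) hw0.le this
  have h1w : 1 ≤ w := by
    have : (1 : ℝ) ^ 8 ≤ w ^ 8 := by rw [hw8, one_pow]; exact hNX
    exact le_of_pow_le_pow_left₀ (by norm_num) hw0.le this
  -- `e^{-3u/2} = e^{3(m+1)/(4T')} NX^{-3/2} ≤ e^6 w^{-12}`
  have hu : Real.exp (-(3 / 2 * (Real.log NX - (((n + 3 : ℕ) : ℝ) + 1) / (2 * T')))) ≤ Real.exp 6 * (w ^ 12)⁻¹ := by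
    have hsplit : -(3 / 2 * (Real.log NX - (((n + 3 : ℕ) : ℝ) + 1) / (2 * T'))) =
        3 / 2 * ((((n + 3 : ℕ) : ℝ) + 1) / (2 * T')) + (-(3 / 2) * Real.log NX) := by ring
    rw [hsplit, Real.exp_add]
    have h1 : Real.exp (3 / 2 * ((((n + 3 : ℕ) : ℝ) + 1) / (2 * T'))) ≤ Real.exp 6 := by
      refine Real.exp_le_exp.mpr ?_
      have hn4 : (n : ℝ) ≤ 4 := by exact_mod_cast hn
      have : (((n + 3 : ℕ) : ℝ) + 1) / (2 * T') ≤ 4 := by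
        rw [div_le_iff₀ (by positivity)]; push_cast; nlinarith
      linarith
    have h2 : Real.exp (-(3 / 2) * Real.log NX) = (w ^ 12)⁻¹ := by
      rw [show -(3 / 2) * Real.log NX = Real.log NX * (-(3 / 2)) by ring, ← Real.rpow_def_of_pos hNX0, hw,
        ← Real.rpow_natCast, ← Real.rpow_mul hNX0.le, ← Real.rpow_neg hNX0.le]
      norm_num
    rw [h2]
    exact mul_le_mul_of_nonneg_right h1 (by positivity)
  -- assemble
  have hz11 : z ^ (2 * (n + 1)) * z ≤ w ^ 11 := by
    rw [← pow_succ]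
    calc z ^ (2 * (n + 1) + 1) ≤ w ^ (2 * (n + 1) + 1) := pow_le_pow_left₀ hz0 hzw _
      _ ≤ w ^ 11 := pow_le_pow_right₀ h1w (by omega)
  have hE : Real.exp (2 * (n : ℝ)) ≤ Real.exp 8 := by
    refine Real.exp_le_exp.mpr ?_
    have : (n : ℝ) ≤ 4 := by exact_mod_cast hn
    linarith
  have hT15 : T' ^ 15 ≤ (2 * P) ^ 15 := pow_le_pow_left₀ (by linarith) hT2 15
  rw [lemma44Err, ← hd', ← hC]
  -- the left side ≤ h d e^{2n} C e^6 w^{-12} w^{11} / 3 ≤ (stuff) P^{17} / w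
  calc (h : ℝ) * z ^ (2 * (n + 1)) *
        (1 / 3 * (d * Real.exp (2 * n)) * C * Real.exp (-(3 / 2 * (Real.log NX - (((n + 3 : ℕ) : ℝ) + 1) / (2 * T')))) * z)
      = 1 / 3 * (h * d * Real.exp (2 * n) * C) * Real.exp (-(3 / 2 * (Real.log NX - (((n + 3 : ℕ) : ℝ) + 1) / (2 * T')))) *
          (z ^ (2 * (n + 1)) * z) := by ring
    _ ≤ 1 / 3 * (P * P * Real.exp 8 * (Real.exp 40 * (2 * P) ^ 15)) * (Real.exp 6 * (w ^ 12)⁻¹) * w ^ 11 := by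
        gcongr
        · exact hCle.trans (mul_le_mul_of_nonneg_left hT15 (by positivity))
    _ = (1 / 3 * Real.exp 8 * Real.exp 40 * Real.exp 6 * 2 ^ 15) * P ^ 17 * w⁻¹ := by
        field_simp
    _ ≤ P ^ 94 * P ^ 17 * w⁻¹ := by
        have hstuff : 1 / 3 * Real.exp 8 * Real.exp 40 * Real.exp 6 * (2 : ℝ) ^ 15 ≤ P ^ 94 := by
          have h54 : Real.exp 8 * Real.exp 40 * Real.exp 6 = Real.exp 54 := by
            rw [← Real.exp_add, ← Real.exp_add]; norm_num
          have hexp : Real.exp 54 ≤ (2 : ℝ) ^ 78 := by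
            have := Real.exp_one_lt_d9
            have h : Real.exp 54 = (Real.exp 1) ^ 54 := by rw [← Real.exp_nat_mul]; norm_num
            rw [h]
            calc (Real.exp 1) ^ 54 ≤ (2.72 : ℝ) ^ 54 := pow_le_pow_left₀ (by positivity) (by linarith) 54
              _ ≤ 2 ^ 78 := by norm_num
          calc 1 / 3 * Real.exp 8 * Real.exp 40 * Real.exp 6 * (2 : ℝ) ^ 15
              = 1 / 3 * (Real.exp 8 * Real.exp 40 * Real.exp 6) * 2 ^ 15 := by ring
            _ ≤ 1 / 3 * 2 ^ 78 * 2 ^ 15 := by rw [h54]; gcongr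
            _ ≤ 2 ^ 94 := by norm_num
            _ ≤ P ^ 94 := pow_le_pow_left₀ (by norm_num) hP 94
        gcongr
    _ = P ^ 111 * w⁻¹ := by ring

end Literature.NumberTheory.LFunctions.NumberField

end
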